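/-
Copyright (c) 2026 The H21 project. Released under Apache 2.0 license.
-/
import Summits.RiemannHypothesis.RiemannHypothesis.Theorems.PfPersistenceIntruderIndexMono
import Summits.RiemannHypothesis.RiemannHypothesis.Theorems.PfPersistenceWeilParityPair
import HarnessLib

/-!
# PF-persistence THEORY 3 (gen 9) — capacitance monotonicity up the `N`-ladder, MATRIX INSTANCE:
# principal compressions, truncated drivers, the weight-table even blocks
# (publication cell `pub-rhpf`, theory seat 3)

Framing (page 1 of every `pub-rhpf` file): **mechanism/rigidity campaign — nothing here is a claim
about RH.** Everything in this file is PROVED real matrix algebra (no new definitions); no statement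
about `ζ` or about any control family is made; every empirical sentence is labelled DATA and refers
to `run/shared/lean/pub/pub-rhpf/pub-rhpf-theory-3/THEORY-INTRUDER.md` §14.

WHY THIS FILE.  `PfPersistenceIntruderCapacitanceMono` proves, for an ABSTRACT nested pair
(compression hypothesis `⟪Bx,x⟫ = ⟪B'(Jx),Jx⟫`, pullback hypothesis `⟪v,x⟫ = ⟪v',Jx⟫`), that the
off-line capacitance `s = ⟪v, B⁻¹v⟫` and the capacitance form `cᵀMc` are non-decreasing.  Here the
two hypotheses are DISCHARGED for the objects the cell computes with — real symmetric matrices, a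
principal compression `B = B'.submatrix f f` along an injection `f` (zero-extension playing `J`),
drivers truncated along `f` (`d = d' ∘ f`) — in the `dotProduct` / `mulVec` language of
`PfPersistenceIntruderIndexMono`, and instantiated on the weight-table even blocks, which are nested
in `N` for EVERY weight table (`datumOf_nested`):

* §1 the matrix Dirichlet identity `d'ᵀz' − (2d'ᵀx − xᵀB'x) = (z' − x)ᵀB'(z' − x)` and the
  trial lower bound; the EXACT INCREMENT along a principal compression
  `d'ᵀz' − dᵀz = wᵀB'w`, `w = z' − ext(z)`, hence `dᵀz ≤ d'ᵀz'` when `B'` is form-nonnegative;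
* §2 the multi-driver version `cᵀ(M' − M)c = w_cᵀ B' w_c ≥ 0` and the threshold-counting form
  (`#{μ(M) > t}` non-decreasing for every `t`);
* §3 the remainder the cell uses, `B = Q + ∑ⱼ κⱼ·pⱼpⱼᵀ` (`Q` the window block, `pⱼ` on-line
  profiles), inherits nesting from `Q` and truncation of the `pⱼ` (`submatrix_add_sum_vecMulVec`), and
  the weight-table instance: for every `w`, `a`, `N' ≤ N` the capacitance form of the `(a, N')` rung
  is dominated by that of the `(a, N)` rung (`evenBlock_capacitanceForm_mono`).

What is NOT proved: existence of the witnesses `B z = d` (supplied as hypotheses here; in finite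
dimension they exist under positive definiteness — `PfPersistenceIntruderCapacitanceMono.
exists_coercive_of_pos` with `PfPersistenceIntruderWitness`), any rate in `N`, anything in the
`a`-direction, and the DATA premise (form-nonnegativity of the top-rung remainder).

Don't-look sentence (RULING A24 k4): every statement here holds for every weight table and every
symmetric matrix family nested in `N` — Davenport–Heilbronn, Epstein, planted controls alike; nothing
in this file separates `ζ` from a control.

## References
* R. A. Horn, C. R. Johnson, *Matrix Analysis*, 2nd ed. (2013), Thm 4.3.28, Cor. 7.7.4.
  [HornJohnson2013]
* G. H. Golub, C. F. Van Loan, *Matrix Computations*, 4th ed. (2013), §11.3.2. [GolubVanLoan2013]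
-/

open Matrix Finset
open scoped BigOperators

set_option linter.dupNamespace false

namespace Summit.RiemannHypothesis.RiemannHypothesis.Theorems.PfPersistenceIntruderCapacitanceMonoMatrix

open Summit.RiemannHypothesis.RiemannHypothesis.Theorems.PfPersistence
open Summit.RiemannHypothesis.RiemannHypothesis.Theorems.PfPersistence.F6 (sum_extend_mul)
open Summit.RiemannHypothesis.RiemannHypothesis.Theorems.PfPersistenceIntruderIndexMono
  (dotProduct_extend_mulVec_extend datumOf_nested)

variable {m n : ℕ}

/-! ## 1. Matrix Dirichlet identity; the exact increment along a principal compression -/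

/-- For a symmetric matrix the bilinear form is symmetric: `xᵀ(Mz) = zᵀ(Mx)`. [folklore] -/
theorem dotProduct_mulVec_comm_of_isSymm {M : Matrix (Fin n) (Fin n) ℝ} (hM : M.IsSymm)
    (x z : Fin n → ℝ) : x ⬝ᵥ (M *ᵥ z) = z ⬝ᵥ (M *ᵥ x) := by
  have h : x ᵥ* M = M *ᵥ x := by
    calc x ᵥ* M = x ᵥ* Mᵀ := by rw [hM.eq]
      _ = M *ᵥ x := vecMul_transpose M x
  rw [dotProduct_mulVec, h, dotProduct_comm]

/-- **Matrix Dirichlet identity**: `M` symmetric, `M z = v` ⇒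
`vᵀz − (2vᵀx − xᵀMx) = (z − x)ᵀM(z − x)` for every trial vector `x`.
[cite: GolubVanLoan2013, §11.3.2] -/
theorem dotProduct_sub_trial_eq {M : Matrix (Fin n) (Fin n) ℝ} (hM : M.IsSymm) {z v : Fin n → ℝ}
    (hz : M *ᵥ z = v) (x : Fin n → ℝ) :
    v ⬝ᵥ z - (2 * (v ⬝ᵥ x) - x ⬝ᵥ (M *ᵥ x)) = (z - x) ⬝ᵥ (M *ᵥ (z - x)) := by
  have h2 : z ⬝ᵥ (M *ᵥ x) = v ⬝ᵥ x := by
    rw [dotProduct_mulVec_comm_of_isSymm hM z x, hz, dotProduct_comm]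
  rw [mulVec_sub, sub_dotProduct, dotProduct_sub, dotProduct_sub, h2, hz, dotProduct_comm z v,
    dotProduct_comm x v]
  ring

/-- **Trial lower bound** (matrix Dirichlet principle): `M` symmetric and form-nonnegative,
`M z = v` ⇒ `2vᵀx − xᵀMx ≤ vᵀz` for every `x`. [cite: GolubVanLoan2013, §11.3.2] -/
theorem trial_le_dotProduct {M : Matrix (Fin n) (Fin n) ℝ} (hM : M.IsSymm)
    (hnonneg : ∀ y : Fin n → ℝ, 0 ≤ y ⬝ᵥ (M *ᵥ y)) {z v : Fin n → ℝ} (hz : M *ᵥ z = v)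
    (x : Fin n → ℝ) : 2 * (v ⬝ᵥ x) - x ⬝ᵥ (M *ᵥ x) ≤ v ⬝ᵥ z := by
  have h := dotProduct_sub_trial_eq hM hz x
  have h2 := hnonneg (z - x)
  linarith

/-- Bookkeeping: pairing the zero-extension of `z` along an injection `f` with `d'` is pairing `z`
with the truncation `d' ∘ f`. [folklore] -/
theorem extend_dotProduct (f : Fin m → Fin n) (hf : Function.Injective f) (z : Fin m → ℝ)
    (d' : Fin n → ℝ) : Function.extend f z 0 ⬝ᵥ d' = z ⬝ᵥ (d' ∘ f) :=
  sum_extend_mul f hf z d'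

/-- **Exact increment along a principal compression**: `B'` symmetric, `B' z' = d'`, and on the
compression `(B'.submatrix f f) z = d' ∘ f`; then `d'ᵀz' − (d'∘f)ᵀz = wᵀB'w` with
`w = z' − ext_f(z)` (the zero-extended small witness as a trial vector for the big problem).
[cite: HornJohnson2013, Thm 4.3.28] -/
theorem dotProduct_increment_eq {B' : Matrix (Fin n) (Fin n) ℝ} (hB' : B'.IsSymm)
    (f : Fin m → Fin n) (hf : Function.Injective f) {d' z' : Fin n → ℝ} {z : Fin m → ℝ}
    (hz' : B' *ᵥ z' = d') (hz : B'.submatrix f f *ᵥ z = d' ∘ f) :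
    d' ⬝ᵥ z' - (d' ∘ f) ⬝ᵥ z =
      (z' - Function.extend f z 0) ⬝ᵥ (B' *ᵥ (z' - Function.extend f z 0)) := by
  have h := dotProduct_sub_trial_eq hB' hz' (Function.extend f z 0)
  have e1 : d' ⬝ᵥ Function.extend f z 0 = (d' ∘ f) ⬝ᵥ z := by
    rw [dotProduct_comm, extend_dotProduct f hf, dotProduct_comm]
  have e2 : Function.extend f z 0 ⬝ᵥ (B' *ᵥ Function.extend f z 0) = (d' ∘ f) ⬝ᵥ z := by
    rw [dotProduct_extend_mulVec_extend B' f hf z, hz, dotProduct_comm]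
  rw [e1, e2] at h
  linarith

/-- **The capacitance is non-decreasing along a principal compression** (`B'` symmetric and
form-nonnegative): `(d'∘f)ᵀz ≤ d'ᵀz'`. [cite: HornJohnson2013, Thm 4.3.28] -/
theorem dotProduct_witness_mono {B' : Matrix (Fin n) (Fin n) ℝ} (hB' : B'.IsSymm)
    (hnonneg : ∀ y : Fin n → ℝ, 0 ≤ y ⬝ᵥ (B' *ᵥ y))
    (f : Fin m → Fin n) (hf : Function.Injective f) {d' z' : Fin n → ℝ} {z : Fin m → ℝ}
    (hz' : B' *ᵥ z' = d') (hz : B'.submatrix f f *ᵥ z = d' ∘ f) :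
    (d' ∘ f) ⬝ᵥ z ≤ d' ⬝ᵥ z' := by
  have h := dotProduct_increment_eq hB' f hf hz' hz
  have h2 := hnonneg (z' - Function.extend f z 0)
  linarith

/-! ## 2. Multi-driver: the capacitance matrix is Loewner-monotone along a principal compression -/

section Multi

variable {κ : Type*} [Fintype κ]

/-- Bookkeeping: `∑ᵢ∑ⱼ cᵢcⱼ (Dᵢᵀ Zⱼ) = (∑ cᵢDᵢ)ᵀ(∑ cⱼZⱼ)`. [folklore] -/
theorem sum_sum_mul_dotProduct_eq {l : ℕ} (D Z : κ → Fin l → ℝ) (c : κ → ℝ) :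
    ∑ i, ∑ j, c i * c j * (D i ⬝ᵥ Z j) = (∑ i, c i • D i) ⬝ᵥ (∑ j, c j • Z j) := by
  rw [sum_dotProduct]
  refine Finset.sum_congr rfl fun i _ => ?_
  rw [smul_dotProduct, dotProduct_sum, smul_eq_mul, Finset.mul_sum]
  refine Finset.sum_congr rfl fun j _ => ?_
  rw [dotProduct_smul, smul_eq_mul]; ring

/-- **Exact increment of the capacitance form**: witness families `B' Z'ᵢ = D'ᵢ` (big) and
`(B'.submatrix f f) Zᵢ = D'ᵢ ∘ f` (compressed), `B'` symmetric; for every coefficient vector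
`cᵀM'c − cᵀMc = w_cᵀ B' w_c`, `w_c = ∑ cⱼZ'ⱼ − ext_f(∑ cⱼZⱼ)`. [cite: HornJohnson2013, Thm 4.3.28] -/
theorem capacitanceForm_increment_eq {B' : Matrix (Fin n) (Fin n) ℝ} (hB' : B'.IsSymm)
    (f : Fin m → Fin n) (hf : Function.Injective f) {D' Z' : κ → Fin n → ℝ} {Z : κ → Fin m → ℝ}
    (hZ' : ∀ i, B' *ᵥ Z' i = D' i) (hZ : ∀ i, B'.submatrix f f *ᵥ Z i = D' i ∘ f) (c : κ → ℝ) :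
    ∑ i, ∑ j, c i * c j * (D' i ⬝ᵥ Z' j) - ∑ i, ∑ j, c i * c j * ((D' i ∘ f) ⬝ᵥ Z j) =
      (∑ j, c j • Z' j - Function.extend f (∑ j, c j • Z j) 0) ⬝ᵥ
        (B' *ᵥ (∑ j, c j • Z' j - Function.extend f (∑ j, c j • Z j) 0)) := by
  have hZc' : B' *ᵥ (∑ j, c j • Z' j) = ∑ i, c i • D' i := by
    rw [mulVec_sum]
    exact Finset.sum_congr rfl fun i _ => by rw [mulVec_smul, hZ' i]
  have hZc : B'.submatrix f f *ᵥ (∑ j, c j • Z j) = (∑ i, c i • D' i) ∘ f := by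
    rw [mulVec_sum]
    have : (∑ i, c i • D' i) ∘ f = ∑ i, c i • (D' i ∘ f) := by
      funext l; simp [Finset.sum_apply, Pi.smul_apply]
    rw [this]
    exact Finset.sum_congr rfl fun i _ => by rw [mulVec_smul, hZ i]
  have key := dotProduct_increment_eq hB' f hf hZc' hZc
  have e : (∑ i, c i • D' i) ∘ f = ∑ i, c i • (D' i ∘ f) := by
    funext l; simp [Finset.sum_apply, Pi.smul_apply]
  rw [e] at key
  rw [sum_sum_mul_dotProduct_eq D' Z' c, sum_sum_mul_dotProduct_eq (fun i => D' i ∘ f) Z c]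
  exact key

/-- **Loewner monotonicity of the capacitance matrix along a principal compression**:
`cᵀMc ≤ cᵀM'c` for every `c` (`B'` symmetric, form-nonnegative) — every eigenvalue `μₖ` of the
capacitance matrix is non-decreasing from the compressed rung to the big rung.
[cite: HornJohnson2013, Cor. 7.7.4] -/
theorem capacitanceForm_mono {B' : Matrix (Fin n) (Fin n) ℝ} (hB' : B'.IsSymm)
    (hnonneg : ∀ y : Fin n → ℝ, 0 ≤ y ⬝ᵥ (B' *ᵥ y))
    (f : Fin m → Fin n) (hf : Function.Injective f) {D' Z' : κ → Fin n → ℝ} {Z : κ → Fin m → ℝ}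
    (hZ' : ∀ i, B' *ᵥ Z' i = D' i) (hZ : ∀ i, B'.submatrix f f *ᵥ Z i = D' i ∘ f) (c : κ → ℝ) :
    ∑ i, ∑ j, c i * c j * ((D' i ∘ f) ⬝ᵥ Z j) ≤ ∑ i, ∑ j, c i * c j * (D' i ⬝ᵥ Z' j) := by
  have h := capacitanceForm_increment_eq hB' f hf hZ' hZ c
  have h2 := hnonneg (∑ j, c j • Z' j - Function.extend f (∑ j, c j • Z j) 0)
  linarith

/-- **Counting form, every threshold**: a `k`-dimensional coefficient subspace on which `t·I − M`
is negative definite is one for `t·I − M'`: `#{μ(M) > t} ≤ #{μ(M') > t}`; at `t = 1` this is the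
capacitance-side route to `n₋(a, N') ≤ n₋(a, N)` (`PfPersistenceIntruderIndexMono`).
[cite: HornJohnson2013, Cor. 7.7.4] -/
theorem negSubspace_threshold_mono {B' : Matrix (Fin n) (Fin n) ℝ} (hB' : B'.IsSymm)
    (hnonneg : ∀ y : Fin n → ℝ, 0 ≤ y ⬝ᵥ (B' *ᵥ y))
    (f : Fin m → Fin n) (hf : Function.Injective f) {D' Z' : κ → Fin n → ℝ} {Z : κ → Fin m → ℝ}
    (hZ' : ∀ i, B' *ᵥ Z' i = D' i) (hZ : ∀ i, B'.submatrix f f *ᵥ Z i = D' i ∘ f) (t : ℝ) {k : ℕ}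
    (hk : ∃ U : Submodule ℝ (κ → ℝ), Module.finrank ℝ U = k ∧
      ∀ c ∈ U, c ≠ 0 → (t * ∑ i, c i ^ 2 - ∑ i, ∑ j, c i * c j * ((D' i ∘ f) ⬝ᵥ Z j)) < 0) :
    ∃ U : Submodule ℝ (κ → ℝ), Module.finrank ℝ U = k ∧
      ∀ c ∈ U, c ≠ 0 → (t * ∑ i, c i ^ 2 - ∑ i, ∑ j, c i * c j * (D' i ⬝ᵥ Z' j)) < 0 := by
  obtain ⟨U, hU, hneg⟩ := hk
  refine ⟨U, hU, fun c hc hc0 => ?_⟩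
  have h1 := hneg c hc hc0
  have h2 := capacitanceForm_mono hB' hnonneg f hf hZ' hZ c
  linarith

end Multi

/-! ## 3. The cell's remainder inherits nesting; the weight-table instance -/

/-- **The remainder inherits nesting**: compressing `Q' + ∑ⱼ κⱼ·pⱼpⱼᵀ` along `f` gives
`Q'.submatrix f f + ∑ⱼ κⱼ·(pⱼ∘f)(pⱼ∘f)ᵀ` — the remainder `B = Q + (on-line rank-`r` part)` of a
rung is the principal compression of the next rung's remainder as soon as the window block is
nested and the profiles are truncations. [folklore] -/
theorem submatrix_add_sum_vecMulVec {r : ℕ} (Q' : Matrix (Fin n) (Fin n) ℝ) (κ : Fin r → ℝ)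
    (p : Fin r → Fin n → ℝ) (f : Fin m → Fin n) :
    (Q' + ∑ j, κ j • vecMulVec (p j) (p j)).submatrix f f =
      Q'.submatrix f f + ∑ j, κ j • vecMulVec (p j ∘ f) (p j ∘ f) := by
  ext i l
  simp only [Matrix.submatrix_apply, Matrix.add_apply, Matrix.sum_apply, Matrix.smul_apply,
    vecMulVec_apply, smul_eq_mul, Function.comp_apply]

/-- A sum of scaled outer products `∑ⱼ κⱼ·pⱼpⱼᵀ` with `κⱼ ≥ 0` is form-nonnegative, and adding it
to a symmetric matrix keeps symmetry. [folklore] -/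
theorem isSymm_add_sum_vecMulVec {r : ℕ} {Q' : Matrix (Fin n) (Fin n) ℝ} (hQ' : Q'.IsSymm)
    (κ : Fin r → ℝ) (p : Fin r → Fin n → ℝ) :
    (Q' + ∑ j, κ j • vecMulVec (p j) (p j)).IsSymm := by
  refine Matrix.IsSymm.ext fun i l => ?_
  have hq : Q' l i = Q' i l := hQ'.apply i l
  simp only [Matrix.add_apply, Matrix.sum_apply, Matrix.smul_apply, vecMulVec_apply, smul_eq_mul, hq]
  congr 1
  exact Finset.sum_congr rfl fun j _ => by ring

/-- **Weight-table instance** (every weight table `w`, every `a > 0`, `N' ≤ N`, any on-line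
profiles `pⱼ` with couplings `κⱼ` and any off-line driver profiles `D'ᵢ` on the big rung, truncated to
the small rung): if the big remainder `B' = evenBlock w (a,N) + ∑ⱼ κⱼ pⱼpⱼᵀ` is form-nonnegative
and witness families exist on both rungs, then `cᵀM_{N'}c ≤ cᵀM_N c` for every `c` — every
capacitance eigenvalue is non-decreasing up the `N`-ladder at fixed `a`.
[cite: HornJohnson2013, Cor. 7.7.4] -/
theorem evenBlock_capacitanceForm_mono (w : Weights) {a : ℝ} (ha : 0 < a) {N' N : ℕ} (h : N' ≤ N)
    {r : ℕ} (κ : Fin r → ℝ) (p : Fin r → Fin (N + 1) → ℝ) {κ' : Type*} [Fintype κ']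
    (hnonneg : ∀ y : Fin (N + 1) → ℝ,
      0 ≤ y ⬝ᵥ ((evenBlock w ⟨a, N, ha⟩ + ∑ j, κ j • vecMulVec (p j) (p j)) *ᵥ y))
    {D' Z' : κ' → Fin (N + 1) → ℝ} {Z : κ' → Fin (N' + 1) → ℝ}
    (hZ' : ∀ i, (evenBlock w ⟨a, N, ha⟩ + ∑ j, κ j • vecMulVec (p j) (p j)) *ᵥ Z' i = D' i)
    (hZ : ∀ i, (evenBlock w ⟨a, N', ha⟩ + ∑ j, κ j •
        vecMulVec (p j ∘ Fin.castLE (Nat.succ_le_succ h)) (p j ∘ Fin.castLE (Nat.succ_le_succ h)))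
          *ᵥ Z i = D' i ∘ Fin.castLE (Nat.succ_le_succ h)) (c : κ' → ℝ) :
    ∑ i, ∑ j, c i * c j * ((D' i ∘ Fin.castLE (Nat.succ_le_succ h)) ⬝ᵥ Z j) ≤
      ∑ i, ∑ j, c i * c j * (D' i ⬝ᵥ Z' j) := by
  set f : Fin (N' + 1) → Fin (N + 1) := Fin.castLE (Nat.succ_le_succ h) with hf_def
  have hf : Function.Injective f := Fin.castLE_injective _
  have hB' : (evenBlock w ⟨a, N, ha⟩ + ∑ j, κ j • vecMulVec (p j) (p j)).IsSymm :=
    isSymm_add_sum_vecMulVec (evenBlock_isSymm w ⟨a, N, ha⟩) κ p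
  have hnest : evenBlock w ⟨a, N', ha⟩ + ∑ j, κ j • vecMulVec (p j ∘ f) (p j ∘ f) =
      (evenBlock w ⟨a, N, ha⟩ + ∑ j, κ j • vecMulVec (p j) (p j)).submatrix f f := by
    rw [submatrix_add_sum_vecMulVec]
    have hQ : evenBlock w ⟨a, N', ha⟩ = (evenBlock w ⟨a, N, ha⟩).submatrix f f :=
      datumOf_nested w a ha N' N h
    rw [hQ]
  have hZf : ∀ i, (evenBlock w ⟨a, N, ha⟩ + ∑ j, κ j • vecMulVec (p j) (p j)).submatrix f f *ᵥ Z i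
      = D' i ∘ f := fun i => by rw [← hnest]; exact hZ i
  exact capacitanceForm_mono hB' hnonneg f hf hZ' hZf c

end Summit.RiemannHypothesis.RiemannHypothesis.Theorems.PfPersistenceIntruderCapacitanceMonoMatrix
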